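import Mathlib.Tactic
import HarnessLib

/-!
# Venture HSemireg — the exponent bookkeeping of LEMMA L₂ (two graph conditions) of `widen/W1/TWOCURVE-w1cx2.md`

Computation cell `pub-hsemireg`, squad W1, second-code seat w1-cx-2 (gen 12). Kernel certificate
(linear integer arithmetic only, `omega`; PROOF-ONLY, no definitions) of the HIGH ∕ LOW separation
that drives LEMMA L₂ — the class-wise second-factor Mayer–Vietoris lemma for numerator boxes with
`b' = 2` and TWO order-1 graph conditions —, which in turn makes the two two-curve commutation facts
of the W1 screen account theorems at every window (THEOREM T of the note).

Setting on paper (NOT in this file). Bimonomials `m = (i,j,k,l) ↔ x₁ⁱy₁ʲx₂ᵏy₂ˡ`, `i,k ∈ {0,1,2}`;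
factor level `ℓ(i,j) = i + j` (`j ≥ 0`) ∕ `−j` (`j < 0`); a monomial is in the window `L` iff both
factor levels are `≤ L`. Its pair-restriction to the two curves is `x^{i+k} y^{j+l} ⊗ (direction)`;
write `τ = j + l`. The monomials are split by the second factor into `A = {l ≥ 1} ∪ {l = 0, k = 2}`,
`B = {l ≤ −1}`, `C = {l = 0, k ≤ 1}`; `T = res(span C)` covers, per target sector, an interval of
exponents `τ` ending at `L`, `L−1` or `L−2`; the lemma needs: A-monomials never land BELOW the
interval («never LOW»), B-monomials never ABOVE it («never HIGH») — except the single monomial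
`ν_{0L} = (0, L, 2, −1)`, whose target `x²y^{L−1} ⊗ u₀` is one step above the `x² ⊗ u₀` range
`[−L, L−2]`, and whose weight class is `3L + 1`. Recorded here:

* `A_never_low` — `l ≥ 0`, `ℓ(i,j) ≤ L` ⇒ `τ ≥ −L`;
* `B_x2u0_high_iff` — for `(0,j,2,l) ∈ B` in the window: `τ ≤ L − 1`, with equality iff
  `(j,l) = (L,−1)`; `B_x2u0_k0` — for `(2,j,0,l) ∈ B`: `τ ≤ L − 3`;
* `B_pairs_not_high₁` ∕ `B_pairs_not_high₂` — the pair sources `(2,j,1,l)`, `(1,j,2,l)` of `B` have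
  `τ ≤ L − 3` resp. `τ + 2 ≤ L` (pair range ends at `L − 2`, singles at `L`);
* `B_xy_not_high` (`(1,j,0,l)`, `(0,j,1,l)`: `τ ≤ L − 1`), `B_x4_not_high` (`(2,j,2,l)`: `τ + 2 ≤ L − 1`),
  `B_x2u1_not_high` (`(1,j,1,l)`: `τ ≤ L − 2`), `B_y_not_high` (`(0,j,0,l)`: `τ ≤ L − 1`);
* `class_zero_shape` — weight `2(i+k) + 3(j+l) ≡ 0 (mod 6)` forces `i + k ∈ {0, 3}` and `j + l`
  even (so in class 0 only the `y`-sector occurs); `nu0L_class` — `ν_{0L}` has weight `3L + 1`,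
  never `≡ 0 (mod 3)`, in particular never in class 0.

HONEST FRAMING. Elementary arithmetic; the Lean index of a bookkeeping lemma about ONE SDR gauge on
one abelian surface. No complex, sheaf or variety appears; nothing here says that HC, HC_CM or HC_AV
holds, and nothing here is a new case of anything.
-/

namespace Summit.Ventures.HSemireg

namespace TwoCurveLevelExact

/-- A-monomials never land LOW: `l ≥ 0` and first-factor level `≤ L` give `τ = j + l ≥ −L`. -/
theorem A_never_low {i j l L : ℤ} (hi : 0 ≤ i) (hlev : (0 ≤ j → i + j ≤ L) ∧ (j < 0 → -j ≤ L))
    (hl : 0 ≤ l) : -L ≤ j + l := by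
  omega

/-- The exceptional B-monomial. For `(0,j,2,l)` with `l ≤ −1` in the window (`ℓ(0,j) ≤ L`,
`ℓ(2,l) = −l ≤ L`): `τ ≤ L − 1`, and `τ = L − 1` iff `(j,l) = (L,−1)` — the monomial `ν_{0L}`; every
other one stays inside the `x² ⊗ u₀` range's closure `τ ≤ L − 2`. -/
theorem B_x2u0_high_iff {j l L : ℤ} (hlev : (0 ≤ j → 0 + j ≤ L) ∧ (j < 0 → -j ≤ L))
    (hl : l ≤ -1) (hl2 : -l ≤ L) :
    j + l ≤ L - 1 ∧ (j + l = L - 1 ↔ (j = L ∧ l = -1)) := by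
  constructor
  · omega
  · constructor
    · intro h; omega
    · intro h; omega

/-- `(2,j,0,l) ∈ B` (`ℓ(2,j) ≤ L`, `l ≤ −1`): `τ ≤ L − 3` — never HIGH for the `x² ⊗ u₀` range `[−L, L−2]`. -/
theorem B_x2u0_k0 {j l L : ℤ} (hlev : (0 ≤ j → 2 + j ≤ L) ∧ (j < 0 → -j ≤ L)) (hl : l ≤ -1) :
    j + l ≤ L - 3 ∨ (j < 0 ∧ j + l ≤ -2) := by
  omega

/-- Pair source `(2,j,1,l) ∈ B`: `τ ≤ L − 3` when `j ≥ 0`, and `τ ≤ −2` when `j < 0`; in both cases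
`τ ≤ L − 2`, the end of the pair range, as soon as `L ≥ 1`. -/
theorem B_pairs_not_high₁ {j l L : ℤ} (hlev : (0 ≤ j → 2 + j ≤ L) ∧ (j < 0 → -j ≤ L)) (hl : l ≤ -1)
    (hL : 1 ≤ L) : j + l ≤ L - 2 := by
  omega

/-- Pair source `(1,j,2,l) ∈ B`: `τ + 2 ≤ L` (the pair `y^{τ+2} + y^τ` stays within the single range
`≤ L` and the pair index `τ ≤ L − 2`). -/
theorem B_pairs_not_high₂ {j l L : ℤ} (hlev : (0 ≤ j → 1 + j ≤ L) ∧ (j < 0 → -j ≤ L)) (hl : l ≤ -1)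
    (hL : 1 ≤ L) : j + l + 2 ≤ L := by
  omega

/-- `xy`-sector B-sources `(1,j,0,l)` and `(0,j,1,l)`: `τ ≤ L − 1` (ranges end at `L − 1` ∕ `L`). -/
theorem B_xy_not_high {i j l L : ℤ} (hi0 : 0 ≤ i) (hi1 : i ≤ 1)
    (hlev : (0 ≤ j → i + j ≤ L) ∧ (j < 0 → -j ≤ L)) (hl : l ≤ -1) (hL : 1 ≤ L) :
    j + l ≤ L - 1 := by
  omega

/-- `x⁴`-source `(2,j,2,l) ∈ B` (`x⁴y^τ = xy^{τ+2} + xy^τ`): `τ + 2 ≤ L − 1`. -/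
theorem B_x4_not_high {j l L : ℤ} (hlev : (0 ≤ j → 2 + j ≤ L) ∧ (j < 0 → -j ≤ L)) (hl : l ≤ -1)
    (hL : 1 ≤ L) : j + l + 2 ≤ L - 1 ∨ (j < 0 ∧ j + l + 2 ≤ 0 ∧ 0 ≤ L - 1) := by
  omega

/-- `x² ⊗ u₁`-source `(1,j,1,l) ∈ B`: `τ ≤ L − 2` (range ends at `L − 1`). -/
theorem B_x2u1_not_high {j l L : ℤ} (hlev : (0 ≤ j → 1 + j ≤ L) ∧ (j < 0 → -j ≤ L)) (hl : l ≤ -1)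
    (hL : 1 ≤ L) : j + l ≤ L - 2 := by
  omega

/-- `y ⊗ u₀`-source `(0,j,0,l) ∈ B`: `τ ≤ L − 1` (single range `|τ| ≤ L`). -/
theorem B_y_not_high {j l L : ℤ} (hlev : (0 ≤ j → 0 + j ≤ L) ∧ (j < 0 → -j ≤ L)) (hl : l ≤ -1) :
    j + l ≤ L - 1 := by
  omega

/-- CLASS 0 SHAPE: numerator weight `2(i+k) + 3(j+l) ≡ 0 (mod 6)` with `0 ≤ i, k ≤ 2` forces
`i + k ∈ {0, 3}` and `j + l` even — in class 0 only the `y`-sector (`x⁰y^τ`, `x³y^τ = y^{τ+2} + y^τ`)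
occurs, with even exponents. -/
theorem class_zero_shape {i j k l : ℤ} (hi0 : 0 ≤ i) (hi2 : i ≤ 2) (hk0 : 0 ≤ k) (hk2 : k ≤ 2)
    (hw : (2 * (i + k) + 3 * (j + l)) % 6 = 0) :
    (i + k = 0 ∨ i + k = 3) ∧ (j + l) % 2 = 0 := by
  omega

/-- The exceptional monomial `ν_{0L} = (0,L,2,−1)` has weight `3L + 1`, which is `≡ 1 (mod 3)`:
it never lies in a weight class `≡ 0` or `≡ 2 (mod 3)`, in particular never in class `0 (mod 6)`. -/
theorem nu0L_class (L : ℤ) :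
    (2 * 0 + 3 * L + 2 * 2 + 3 * (-1)) = 3 * L + 1 ∧ (3 * L + 1) % 3 = 1 ∧ (3 * L + 1) % 6 ≠ 0 := by
  omega

/-- The in-window odd-`l` singles of the class-0 `y`-sector (sources `(0,j,0,l)`, `l` odd): from `A`
(`l ≥ 1`) the exponent satisfies `τ ≥ −L + 1`, from `B` (`l ≤ −1`) `τ ≤ L − 1` — out of the single
range `|τ| ≤ L` they are HIGH resp. LOW, and both sides can reach the in-range exponents (the ONE
shared coordinate of LEMMA L₂ (P1) after passing to the pair basis). -/
theorem odd_single_ranges {j l L : ℤ} (hlev : (0 ≤ j → 0 + j ≤ L) ∧ (j < 0 → -j ≤ L))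
    (hl2 : (0 ≤ l → 0 + l ≤ L) ∧ (l < 0 → -l ≤ L)) :
    (1 ≤ l → -L + 1 ≤ j + l) ∧ (l ≤ -1 → j + l ≤ L - 1) := by
  constructor
  · intro h; omega
  · intro h; omega

end TwoCurveLevelExact

end Summit.Ventures.HSemireg
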